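import Literature.NumberTheory.Automorphic.UnitaryGroupTruncatedTracePolynomialExpansionTwo
import HarnessLib

/-!
# LAWS 1–2 of Arthur's truncated trace on the quasi-split `U(J₂)` of a CM field: `k^T` is integrable, `J^T(f)` is a
# polynomial of degree `≤ 1` in `log T` — the `N = 2` twins of the named facts ★ `TruncatedKernelIntegrable` ∕
# ★ `TruncatedTracePolynomial` of ★ `UnitaryGroupArthurTruncatedTrace`, as THEOREMS
(Arthur, *A trace formula for reductive groups I*, Duke Math. J. 45 (1978), Thm. 7.1: `∫ |k^T_𝔬(x)| dx < ∞`;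
Arthur, *The trace formula in invariant form*, Ann. of Math. 114 (1981), §2, Prop. 2.3: `J^T(f)` is a polynomial in
`T`; Rogawski, *Automorphic Representations of Unitary Groups in Three Variables* (1990), §2.2 p. 13 «`J^T(f)` is a
polynomial function of `log(T)` for `T` sufficiently large … (2.1.1) is equal to `Σ J^T_𝔬(f)`» and p. 98 «Let
`G = U(3)`, `U(2)`, or `U(2) × U(1)`»; Shokranian (1992), Thm. (5.7), Rem. (5.8).)

Topic `NumberTheory/Automorphic`; namespace `Literature.NumberTheory.Automorphic.UnitaryGroup`. THEOREMS ONLY over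
accepted tree modules: no definition, no named fact, no instance, no notation, no `sorry`. H-side copy of LAWS 1–5 for
the endoscopic group `H = U(Φ₂) × U(Φ₁)` of the line `Cruxes/H413/Lines/F0_T1InnerFormTraceIdentity.lean` (cell
hodgecm-mathlib, crux H413; census `CENSUS-LAWS-Hside` §1 D2 «the `N = 2` laws are stated as THEOREMS with the body at
`N = 2` — no new named fact» and §3 LAW 3 RECOMMENDATION «class rows first, the totals by summation»). On the `G`-side the
two laws are the `N = 3`-only Prop-definitions ★ `TruncatedKernelIntegrable F E c` ∕ ★ `TruncatedTracePolynomial F E c`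
discharged by ★ `truncatedKernelIntegrable_cm` ∕ ★ `truncatedTracePolynomial_cm`; here, for `U(J₂)` (★
`quasiSplit L⁺ L c 2` at the CM pair `(L⁺, L, complexConj)`), the same two statements are obtained by SUMMATION over the
finitely many live characteristic-polynomial classes from the per-class rows: the coarse expansion ★
`truncatedTrace_eq_sum_truncatedTraceClass_charpoly_two_cm` (★ `UnitaryGroupTruncatedTraceClassExpansionTwo`: per-class
integrability ★ `truncatedKernelClassIntegrable_cm_two` + `k^T = Σ_{𝔬 ∈ S_f} k^T_𝔬`) and the closed form ★
`arthurTrace_eq_sum_classPolynomial_eval_zero_charpoly_cm_two` (★ `UnitaryGroupTruncatedTracePolynomialExpansionTwo`: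
`Σ_{𝔬 ∈ S_f} p_𝔬` computes `J^T(f)`, all `p_𝔬` of degree `≤ 1`). NO hypothesis beyond the letters (`ν` a Haar measure of
`N(𝔸)` with a fundamental domain `𝓕` of `N(L⁺)`, `μ` an automorphic measure, `f` a test function).

* **`truncatedKernelIntegrable_cm_two`** — LAW 1: `∃ T₀, ∀ T > T₀`, the descended `k^T` is `μ`-integrable on
  `U(J₂)(L⁺)\U(J₂)(𝔸)`.
* **`truncatedTracePolynomial_cm_two`** — LAW 2: `∃ p : ℂ[X]`, `deg p ≤ 1`, `p` computes `J^T(f)` above a threshold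
  (★ `IsTruncatedTracePolynomial`).
* `truncatedTracePolynomial_natDegree_le_one_cm_two` — consequences (the `N = 2` twin of ★
  `TruncatedTracePolynomial.natDegree_le`): Arthur's polynomial ★ `truncatedTracePolynomial μ ν 𝓕 f` has degree `≤ 1`,
  computes `J^T(f)`, and `J(f) =` ★ `arthurTrace μ ν 𝓕 f` is its constant coefficient.

## References

* J. Arthur, *A trace formula for reductive groups I*, Duke Math. J. 45 (1978), Thm. 7.1 [Arthur1978TraceFormulaI].
* J. Arthur, *The trace formula in invariant form*, Ann. of Math. 114 (1981), §2, Prop. 2.3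
  [Arthur1981TraceFormulaInvariantForm].
* J. D. Rogawski, *Automorphic Representations of Unitary Groups in Three Variables*, Ann. of Math. Stud. 123 (1990),
  §2.2 (p. 13), §7.3 (p. 98) [Rogawski1990].
* S. Shokranian, *The Selberg–Arthur trace formula*, LNM 1503 (1992), Thm. (5.7), Rem. (5.8) [Shokranian1992].
-/

set_option autoImplicit false

noncomputable section

open MeasureTheory Measure NumberField NumberField.mixedEmbedding IsDedekindDomain Set Polynomial
open scoped NNReal ENNReal Pointwise MatrixGroups Classical

namespace Literature.NumberTheory.Automorphic

namespace UnitaryGroup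

/-- **LAW 1 of `U(J₂)` — `k^T` IS INTEGRABLE ON `U(J₂)(L⁺)\U(J₂)(𝔸_{L⁺})`** (CM pair, NO hypothesis): for every Haar
measure `ν` of `N(𝔸)` and fundamental domain `𝓕` of `N(L⁺)`, every automorphic measure `μ` and every test function `f`
there is `T₀` with `[g] ↦ k^T(g⁻¹)` `μ`-integrable for all `T > T₀` — the statement of ★ `TruncatedKernelIntegrable` at
`N = 2`, by summation of the per-class rows: `k^T = Σ_{𝔬 ∈ S_f} k^T_𝔬` with each `k^T_𝔬` integrable (★
`truncatedTrace_eq_sum_truncatedTraceClass_charpoly_two_cm`). [cite: Arthur1978TraceFormulaI, Thm. 7.1]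
[cite: Rogawski1990, §2.2 (p. 13)] -/
theorem truncatedKernelIntegrable_cm_two (L : Type) [Field L] [NumberField L] [IsCMField L] :
    ∀ [MeasurableSpace (adelicUnipotent (↥(maximalRealSubfield L)) L (IsCMField.complexConj L) 2)]
      [BorelSpace (adelicUnipotent (↥(maximalRealSubfield L)) L (IsCMField.complexConj L) 2)]
      (ν : Measure (adelicUnipotent (↥(maximalRealSubfield L)) L (IsCMField.complexConj L) 2)) [ν.IsHaarMeasure]
      (𝓕 : Set (adelicUnipotent (↥(maximalRealSubfield L)) L (IsCMField.complexConj L) 2)),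
      IsFundamentalDomain (rationalUnipotent (↥(maximalRealSubfield L)) L (IsCMField.complexConj L) 2) 𝓕 ν →
        ∀ (μ : Measure (quasiSplit (↥(maximalRealSubfield L)) L (IsCMField.complexConj L) 2).automorphicQuotient)
          [(quasiSplit (↥(maximalRealSubfield L)) L (IsCMField.complexConj L) 2).IsAutomorphicMeasure μ]
          (f : (quasiSplit (↥(maximalRealSubfield L)) L (IsCMField.complexConj L) 2).Adelic → ℂ),
          IsQuasiSplitTest (↥(maximalRealSubfield L)) L (IsCMField.complexConj L) 2 f →
          ∃ T₀ : ℝ≥0, ∀ T : ℝ≥0, T₀ < T →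
            Integrable ((quasiSplit (↥(maximalRealSubfield L)) L (IsCMField.complexConj L) 2).quotFun
              (truncatedKernel ν 𝓕 T f)) μ := by
  intro mN bN ν hν 𝓕 h𝓕 μ hμ f hf
  obtain ⟨S, T₀, hT₀⟩ := truncatedTrace_eq_sum_truncatedTraceClass_charpoly_two_cm L ν 𝓕 h𝓕 μ f hf
  refine ⟨T₀, fun T hT => ?_⟩
  obtain ⟨hint, hk, -⟩ := hT₀ T hT
  -- the descended `k^T` is the finite sum of the descended `k^T_𝔬`, `𝔬 ∈ S_f`
  have h : (quasiSplit (↥(maximalRealSubfield L)) L (IsCMField.complexConj L) 2).quotFun (truncatedKernel ν 𝓕 T f) =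
      ∑ p ∈ S, (quasiSplit (↥(maximalRealSubfield L)) L (IsCMField.complexConj L) 2).quotFun (truncatedKernelClass ν 𝓕 T
        (fun γ : ↥(quasiSplit (↥(maximalRealSubfield L)) L (IsCMField.complexConj L) 2).arithmeticSubgroup =>
          ((adelicVal (↥(maximalRealSubfield L)) L (IsCMField.complexConj L) 2 _
              (γ : (quasiSplit (↥(maximalRealSubfield L)) L (IsCMField.complexConj L) 2).Adelic) :
            GL (Fin 2) (AdeleRing (𝓞 L) L)) : Matrix (Fin 2) (Fin 2) (AdeleRing (𝓞 L) L)).charpoly) p f) := by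
    funext q
    simp only [AdelicGroupData.quotFun, Finset.sum_apply]
    exact hk _
  rw [h]
  exact integrable_finsetSum' S hint

/-- **LAW 2 of `U(J₂)` — `J^T(f)` IS A POLYNOMIAL OF DEGREE `≤ 1` IN `log T`** (CM pair, NO hypothesis): for `ν`, `𝓕`,
`μ`, `f` as above there is `p ∈ ℂ[X]` with `deg p ≤ 1` computing `J^T(f) = p(log T)` for all large `T` (★
`IsTruncatedTracePolynomial`) — the statement of ★ `TruncatedTracePolynomial` at `N = 2`, with `p := Σ_{𝔬 ∈ S_f} p_𝔬`
the sum of the class polynomials (★ `arthurTrace_eq_sum_classPolynomial_eval_zero_charpoly_cm_two`).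
[cite: Arthur1981TraceFormulaInvariantForm, Prop. 2.3] [cite: Rogawski1990, §2.2 (p. 13)]
[cite: Shokranian1992, Thm. (5.7) and Rem. (5.8)] -/
theorem truncatedTracePolynomial_cm_two (L : Type) [Field L] [NumberField L] [IsCMField L] :
    ∀ [MeasurableSpace (adelicUnipotent (↥(maximalRealSubfield L)) L (IsCMField.complexConj L) 2)]
      [BorelSpace (adelicUnipotent (↥(maximalRealSubfield L)) L (IsCMField.complexConj L) 2)]
      (ν : Measure (adelicUnipotent (↥(maximalRealSubfield L)) L (IsCMField.complexConj L) 2)) [ν.IsHaarMeasure]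
      (𝓕 : Set (adelicUnipotent (↥(maximalRealSubfield L)) L (IsCMField.complexConj L) 2)),
      IsFundamentalDomain (rationalUnipotent (↥(maximalRealSubfield L)) L (IsCMField.complexConj L) 2) 𝓕 ν →
        ∀ (μ : Measure (quasiSplit (↥(maximalRealSubfield L)) L (IsCMField.complexConj L) 2).automorphicQuotient)
          [(quasiSplit (↥(maximalRealSubfield L)) L (IsCMField.complexConj L) 2).IsAutomorphicMeasure μ]
          (f : (quasiSplit (↥(maximalRealSubfield L)) L (IsCMField.complexConj L) 2).Adelic → ℂ),
          IsQuasiSplitTest (↥(maximalRealSubfield L)) L (IsCMField.complexConj L) 2 f →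
          ∃ p : ℂ[X], p.natDegree ≤ 1 ∧ IsTruncatedTracePolynomial μ ν 𝓕 f p := by
  intro mN bN ν hν 𝓕 h𝓕 μ hμ f hf
  obtain ⟨S, P, -, -, hpoly, hdeg, -, -⟩ := arthurTrace_eq_sum_classPolynomial_eval_zero_charpoly_cm_two L ν 𝓕 h𝓕 μ f hf
  exact ⟨∑ i ∈ S, P i, hdeg, hpoly⟩

/-- **Consequences of LAW 2 on `U(J₂)`** (the `N = 2` twin of ★ `TruncatedTracePolynomial.natDegree_le`, unconditional):
Arthur's polynomial ★ `truncatedTracePolynomial μ ν 𝓕 f` of a test function has degree `≤ 1`, computes `J^T(f)` above a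
threshold, and `J(f) =` ★ `arthurTrace μ ν 𝓕 f` is its constant coefficient. [cite: Shokranian1992, Thm. (5.7) and Rem. (5.8)]
[cite: Rogawski1990, §2.2 (p. 13)] -/
theorem truncatedTracePolynomial_natDegree_le_one_cm_two (L : Type) [Field L] [NumberField L] [IsCMField L] :
    ∀ [MeasurableSpace (adelicUnipotent (↥(maximalRealSubfield L)) L (IsCMField.complexConj L) 2)]
      [BorelSpace (adelicUnipotent (↥(maximalRealSubfield L)) L (IsCMField.complexConj L) 2)]
      (ν : Measure (adelicUnipotent (↥(maximalRealSubfield L)) L (IsCMField.complexConj L) 2)) [ν.IsHaarMeasure]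
      (𝓕 : Set (adelicUnipotent (↥(maximalRealSubfield L)) L (IsCMField.complexConj L) 2)),
      IsFundamentalDomain (rationalUnipotent (↥(maximalRealSubfield L)) L (IsCMField.complexConj L) 2) 𝓕 ν →
        ∀ (μ : Measure (quasiSplit (↥(maximalRealSubfield L)) L (IsCMField.complexConj L) 2).automorphicQuotient)
          [(quasiSplit (↥(maximalRealSubfield L)) L (IsCMField.complexConj L) 2).IsAutomorphicMeasure μ]
          (f : (quasiSplit (↥(maximalRealSubfield L)) L (IsCMField.complexConj L) 2).Adelic → ℂ),
          IsQuasiSplitTest (↥(maximalRealSubfield L)) L (IsCMField.complexConj L) 2 f →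
          (truncatedTracePolynomial μ ν 𝓕 f).natDegree ≤ 1 ∧
            IsTruncatedTracePolynomial μ ν 𝓕 f (truncatedTracePolynomial μ ν 𝓕 f) ∧
            arthurTrace μ ν 𝓕 f = (truncatedTracePolynomial μ ν 𝓕 f).coeff 0 := by
  intro mN bN ν hν 𝓕 h𝓕 μ hμ f hf
  obtain ⟨p, hp1, hp⟩ := truncatedTracePolynomial_cm_two L ν 𝓕 h𝓕 μ f hf
  rw [truncatedTracePolynomial_eq hp, arthurTrace_eq_eval hp, ← coeff_zero_eq_eval_zero]
  exact ⟨hp1, hp, rfl⟩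

end UnitaryGroup

end Literature.NumberTheory.Automorphic
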